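import Summits.QuantumFields.YangMills.Theorems.IR.BlockedActivityDefs
import Summits.QuantumFields.YangMills.Theorems.BalabanLadderIROnsetReductionSC
import Literature.Probability.LatticeModels.LocalPerturbationObservablesBounds
import HarnessLib

/-!
# Crux `IR` (stmt-QuantumFields-19354), lane B «strong coupling AFTER BLOCKING»: the blocked-activity class gives the
# universal shell condition, and the construction statement closes `stub_onsetUcSC`'s statement by name

Proof module for item `stmt-QuantumFields-19354` (`--supports`; it closes nothing), lane `ym-19354-onsetsc-p2`; definitions in
`Theorems/IR/BlockedActivityDefs`.  All proved, no `sorry`, axioms ⊆ {propext, Classical.choice, Quot.sound}.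

* §2 the adjacency data the tree's Kotecký–Preiss layer wants: `CellAdj` symmetric, `cellNbr` lists the neighbours, `#cellNbr = 81`.
* §3 `BlockedRep.norm_integral_sub_ref_le` — ONE representation: under `e a 82² ≤ 1/2`, `e a 2⁸¹ ≤ 1` the kernel expectation of
  every centre observable is within `2 e a 2⁸¹ (2e)⁸²` of the σ-INDEPENDENT reference value `∫ obs f dμ`, for EVERY exterior
  datum (the tree's volume-uniform bound `norm_pertExpect_sub_integral_le'`: Dobrushin exclusion cost + Peierls counting, cells
  `S = {0}`, `B = 1`, `Δ = 81`);
  **`univShellCond_of_blockedActivity`** — `BlockedActivityClass ρ β b n a`, `e a 82² ≤ 1/2`, `e a 2⁸¹ ≤ 1`,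
  `4 e a 2⁸¹ (2e)⁸² ≤ ε` ⇒ `OnsetFormats.UnivShellCond ρ β b n ε` (two exterior data move the expectation by at most twice its
  distance to the common reference value — no agreement hypothesis, NO TYPICAL CLASS);
  `univShellCond_of_blockedActivity_radius` — packaged with the explicit radius `radius ε = ε ∕ (4 e 2⁸¹ (2e)⁸²)` (`ε ≤ 1`);
  `univOnsetAt_of_blockedActivityOnsetAt` — per group: a blocked-activity onset ⇒ «∃β₂ ∀β≥β₂ ∃b≥1, UnivShellCond ρ β b 1 (1/3552)».
* §4 **`onsetMixingTypicalUKPcSC_of_blockedActivityOnsetSC : BlockedActivityOnsetSC → OnsetFormatsUc.OnsetMixingTypicalUKPcSC`** —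
  the registered stub's statement BY NAME, through the lead's `SupplierSC.onsetMixingTypicalUKPcSC_of_univOnsetSC` (p524177,
  Dobrushin–Shlosman bootstrap, class `Typ ≡ univ`) at `(n, ε) = (1, 1/3552)` (`ε · shellCount 1 = 1/2 < 1`).

So lane B's census sentence reads: `stub_onsetUcSC` ⇐ `BlockedActivityOnsetSC` [kernel, this file] — «for every simply connected
compact simple `G`, every `r` and every radius `a > 0`, at all large `β` some mesh `b(β, a)` admits a blocked local-perturbation
representation of the YM kernels of the window-1 cell regions with cell factors `≤ a`» — the weak-coupling research content (no
source; Tomboulis' decimation programme arXiv:0707.2179 is the nearest attempt, disputed arXiv:0901.4246); the numbers: radius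
`a(1/3552) = 1 ∕ (3552 · 4e · 2⁸¹ · (2e)⁸²) ≈ 1.4·10⁻⁸⁹` (Peierls constants of sup-adjacency in `ℤ⁴`, `Δ = 81`).
HONEST FRAMING: reductions among OPEN statements; not a gap, not Clay.
-/

set_option autoImplicit false

noncomputable section

open MeasureTheory
open Literature.MathematicalPhysics.QuantumFieldTheory Literature.MathematicalPhysics.QuantumLattice
open Literature.Probability.LatticeModels (IsLocalPerturbation IsLocalObservable pertExpect
  norm_pertExpect_sub_integral_le')
open Summit.QuantumFields.YangMills.Cruxes.IR.Tempered (cellEdges windowCells regionEdges)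
open Summit.QuantumFields.YangMills.Cruxes.IR.OnsetFormats (shellCount UnivShellCond)
open Summit.QuantumFields.YangMills.Cruxes.IR.OnsetFormatsUc (OnsetMixingTypicalUKPcSC)

namespace Summit.QuantumFields.YangMills.Cruxes.IR.BlockedActivity

/-! ## §2 The adjacency data of the tree's Kotecký–Preiss layer: symmetric, `81` neighbours -/

/-- Cell adjacency is symmetric. -/
theorem cellAdj_symm (x y : Cell) (h : CellAdj x y) : CellAdj y x := fun i => by rw [abs_sub_comm]; exact h i

/-- Adjacent cells are neighbours. -/
theorem mem_cellNbr_of_cellAdj (x y : Cell) (h : CellAdj x y) : y ∈ cellNbr x := by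
  simp only [cellNbr, Fintype.mem_piFinset, Finset.mem_Icc]
  intro i
  have := h i
  rw [abs_le] at this
  constructor <;> omega

/-- A cell has `81` neighbours. -/
theorem card_cellNbr (x : Cell) : (cellNbr x).card = 81 := by
  unfold cellNbr
  rw [Fintype.card_piFinset]
  have : ∀ i : Fin 4, (Finset.Icc (x i - 1) (x i + 1)).card = 3 := fun i => by
    rw [Int.card_Icc]
    have : x i + 1 + 1 - (x i - 1) = ((3 : ℕ) : ℤ) := by push_cast; ring
    rw [this, Int.toNat_natCast]
  simp [this]

/-- Hence at most `81`. -/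
theorem card_cellNbr_le (x : Cell) : (cellNbr x).card ≤ 81 := (card_cellNbr x).le

/-! ## §3 The universal shell condition from the blocked-activity class (Kotecký–Preiss ∕ Dobrushin, volume-uniform) -/

section Shell

variable {G : Type} [Group G] [TopologicalSpace G] [IsTopologicalGroup G] [CompactSpace G]
  [MeasurableSpace G] [BorelSpace G] {N : ℕ} {ρ : G →* Matrix (Fin N) (Fin N) ℂ} {β : ℝ} {b n : ℕ} {a ε : ℝ}

/-- **The Kotecký–Preiss step for one representation.**  Under the tree's smallness conditions
`e a 82² ≤ 1/2`, `e a 2⁸¹ ≤ 1` the kernel expectation of every centre observable is within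
`2 e a 2⁸¹ (2e)⁸²` of the σ-INDEPENDENT reference value `∫ obs f dμ`, for EVERY exterior datum `σ`
(tree `norm_pertExpect_sub_integral_le'`, cells `S = {0}`, bound `B = 1`, `Δ = 81`). -/
theorem BlockedRep.norm_integral_sub_ref_le {w : Fin 4 → ℤ → ℤ} {Y : Finset Cell} (R : BlockedRep ρ β w Y a)
    (h1 : Real.exp 1 * a * ((81 : ℝ) + 1) ^ 2 ≤ 1 / 2) (h2 : Real.exp 1 * a * 2 ^ 81 ≤ 1)
    (σ : LGConfig 4 G) {f : LGConfig 4 G → ℝ} (hf : IsCentreObs w f) :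
    ‖((∫ U, f U ∂(ymSpecification ρ β (regionEdges w Y) σ) : ℝ) : ℂ) - ∫ ω, R.obs f ω ∂(R.μ)‖ ≤
      2 * Real.exp 1 * a * 2 ^ 81 * (2 * Real.exp 1) ^ 82 := by
  letI := R.mΩ
  haveI := R.isProb
  have h := norm_pertExpect_sub_integral_le' (R := CellAdj) (nbr := cellNbr) (Δ := 81) cellAdj_symm card_cellNbr_le
    mem_cellNbr_of_cellAdj (R.perturbation σ) (R.obs_local f hf) (by exact_mod_cast h1) h2 R.C
  rw [Finset.card_singleton] at h
  rw [R.rep σ f hf]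
  refine h.trans (le_of_eq ?_)
  norm_num

/-- **Lane B reduction: the blocked-activity class gives the universal shell condition.**  If the mesh-`b` theory is in
the blocked-activity class of radius `a` at window `n`, with `e a 82² ≤ 1/2`, `e a 2⁸¹ ≤ 1` and
`4 e a 2⁸¹ (2e)⁸² ≤ ε`, then `OnsetFormats.UnivShellCond ρ β b n ε`: two exterior data move the centre-cell kernel
expectation by at most twice its distance to the common reference value.  No agreement hypothesis and no typical class
are used («no typical-class conditioning at all»). -/
theorem univShellCond_of_blockedActivity (hC : BlockedActivityClass ρ β b n a)
    (h1 : Real.exp 1 * a * ((81 : ℝ) + 1) ^ 2 ≤ 1 / 2) (h2 : Real.exp 1 * a * 2 ^ 81 ≤ 1)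
    (h3 : 4 * Real.exp 1 * a * 2 ^ 81 * (2 * Real.exp 1) ^ 82 ≤ ε) : UnivShellCond ρ β b n ε := by
  intro w hw Y hY h0 σ σ' _ f hf hfm hf01
  obtain ⟨R⟩ := hC w hw Y hY h0
  have hfo : IsCentreObs w f := ⟨hf, hfm, hf01⟩
  have hA := R.norm_integral_sub_ref_le h1 h2 σ hfo
  have hB := R.norm_integral_sub_ref_le h1 h2 σ' hfo
  set E : ℂ := ((∫ U, f U ∂(ymSpecification ρ β (regionEdges w Y) σ) : ℝ) : ℂ) with hE
  set E' : ℂ := ((∫ U, f U ∂(ymSpecification ρ β (regionEdges w Y) σ') : ℝ) : ℂ) with hE'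
  set I : ℂ := ∫ ω, R.obs f ω ∂(R.μ) with hI
  have hdiff : ‖E - E'‖ ≤ 4 * Real.exp 1 * a * 2 ^ 81 * (2 * Real.exp 1) ^ 82 := by
    calc ‖E - E'‖ = ‖(E - I) - (E' - I)‖ := by ring_nf
      _ ≤ ‖E - I‖ + ‖E' - I‖ := norm_sub_le _ _
      _ ≤ 2 * Real.exp 1 * a * 2 ^ 81 * (2 * Real.exp 1) ^ 82 +
            2 * Real.exp 1 * a * 2 ^ 81 * (2 * Real.exp 1) ^ 82 := add_le_add hA hB
      _ = _ := by ring
  have hreal : ‖E - E'‖ = |(∫ U, f U ∂(ymSpecification ρ β (regionEdges w Y) σ)) -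
      ∫ U, f U ∂(ymSpecification ρ β (regionEdges w Y) σ')| := by
    rw [hE, hE', ← Complex.ofReal_sub, Complex.norm_real, Real.norm_eq_abs]
  rw [← hreal]
  exact hdiff.trans h3

/-- The denominator of the activity radius: `D = 4 e 2⁸¹ (2e)⁸²` (`≈ 6·10⁸⁵`). -/
def radiusDen : ℝ := 4 * Real.exp 1 * 2 ^ 81 * (2 * Real.exp 1) ^ 82

/-- The activity radius used at a target accuracy `ε`: `a(ε) = ε ∕ (4 e 2⁸¹ (2e)⁸²)`. -/
def radius (ε : ℝ) : ℝ := ε / radiusDen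

/-- The denominator is positive. -/
theorem radiusDen_pos : 0 < radiusDen := by unfold radiusDen; positivity

/-- The radius is positive for positive `ε`. -/
theorem radius_pos (hε : 0 < ε) : 0 < radius ε := div_pos hε radiusDen_pos

/-- The three smallness conditions hold at the radius `a(ε)` for `ε ≤ 1`. -/
theorem smallness_radius (hε1 : ε ≤ 1) :
    Real.exp 1 * radius ε * ((81 : ℝ) + 1) ^ 2 ≤ 1 / 2 ∧ Real.exp 1 * radius ε * 2 ^ 81 ≤ 1 ∧
      4 * Real.exp 1 * radius ε * 2 ^ 81 * (2 * Real.exp 1) ^ 82 ≤ ε := by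
  have he0 : 0 < Real.exp 1 := Real.exp_pos 1
  have he1 : 1 ≤ Real.exp 1 := by have := Real.add_one_le_exp (1 : ℝ); linarith
  have hP : (1 : ℝ) ≤ (2 * Real.exp 1) ^ 82 := one_le_pow₀ (by linarith)
  have hP0 : (0 : ℝ) < (2 * Real.exp 1) ^ 82 := by positivity
  have hD0 : 0 < radiusDen := radiusDen_pos
  have hD : radiusDen = 4 * Real.exp 1 * 2 ^ 81 * (2 * Real.exp 1) ^ 82 := rfl
  refine ⟨?_, ?_, ?_⟩
  · -- `e ε 82² ≤ D / 2`
    have hgoal : Real.exp 1 * radius ε * ((81 : ℝ) + 1) ^ 2 = Real.exp 1 * ε * 6724 / radiusDen := by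
      unfold radius; ring
    rw [hgoal, div_le_iff₀ hD0, hD]
    calc Real.exp 1 * ε * 6724 ≤ Real.exp 1 * 1 * 6724 := by gcongr
      _ ≤ Real.exp 1 * (2 * 2 ^ 81) * 1 := by nlinarith
      _ ≤ Real.exp 1 * (2 * 2 ^ 81) * (2 * Real.exp 1) ^ 82 := by gcongr
      _ = 1 / 2 * (4 * Real.exp 1 * 2 ^ 81 * (2 * Real.exp 1) ^ 82) := by ring
  · -- `e a 2⁸¹ = ε / (4 (2e)⁸²) ≤ 1`
    have hgoal : Real.exp 1 * radius ε * 2 ^ 81 = Real.exp 1 * ε * 2 ^ 81 / radiusDen := by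
      unfold radius; ring
    rw [hgoal, div_le_iff₀ hD0, hD]
    calc Real.exp 1 * ε * 2 ^ 81 ≤ Real.exp 1 * 1 * 2 ^ 81 := by gcongr
      _ = Real.exp 1 * 2 ^ 81 * 1 * 1 := by ring
      _ ≤ Real.exp 1 * 2 ^ 81 * 4 * (2 * Real.exp 1) ^ 82 := by gcongr; norm_num
      _ = 1 * (4 * Real.exp 1 * 2 ^ 81 * (2 * Real.exp 1) ^ 82) := by ring
  · -- exact: `4 e a(ε) 2⁸¹ (2e)⁸² = ε`
    have hgoal : 4 * Real.exp 1 * radius ε * 2 ^ 81 * (2 * Real.exp 1) ^ 82 = ε * radiusDen / radiusDen := by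
      unfold radius; rw [hD]; ring
    rw [hgoal, mul_div_cancel_right₀ ε hD0.ne']

/-- Window `n`, packaged: the blocked-activity class at radius `a ≤ a(ε) = ε ∕ (4 e 2⁸¹ (2e)⁸²)`, `ε ≤ 1`, gives
`UnivShellCond ρ β b n ε`. -/
theorem univShellCond_of_blockedActivity_radius (hC : BlockedActivityClass ρ β b n a)
    (hε1 : ε ≤ 1) (haε : a ≤ radius ε) : UnivShellCond ρ β b n ε := by
  obtain ⟨h1, h2, h3⟩ := smallness_radius hε1
  have he0 : 0 < Real.exp 1 := Real.exp_pos 1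
  refine univShellCond_of_blockedActivity hC ?_ ?_ ?_
  · calc Real.exp 1 * a * ((81 : ℝ) + 1) ^ 2 ≤ Real.exp 1 * radius ε * ((81 : ℝ) + 1) ^ 2 := by gcongr
      _ ≤ 1 / 2 := h1
  · calc Real.exp 1 * a * 2 ^ 81 ≤ Real.exp 1 * radius ε * 2 ^ 81 := by gcongr
      _ ≤ 1 := h2
  · calc 4 * Real.exp 1 * a * 2 ^ 81 * (2 * Real.exp 1) ^ 82
          ≤ 4 * Real.exp 1 * radius ε * 2 ^ 81 * (2 * Real.exp 1) ^ 82 := by gcongr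
      _ ≤ ε := h3

/-- **Per group: a blocked-activity onset gives a universal onset at window `1` with `ε = 1/3552`** (`ε · shellCount 1 = 1/2 < 1`). -/
theorem univOnsetAt_of_blockedActivityOnsetAt (h : BlockedActivityOnsetAt ρ) :
    ∃ β₂ : ℝ, ∀ β : ℝ, β₂ ≤ β → ∃ b : ℕ, 1 ≤ b ∧ UnivShellCond ρ β b 1 (1 / 3552) := by
  obtain ⟨β₂, hβ⟩ := h (radius (1 / 3552)) (radius_pos (by norm_num))
  refine ⟨β₂, fun β hb => ?_⟩
  obtain ⟨b, hb1, hC⟩ := hβ β hb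
  exact ⟨b, hb1, univShellCond_of_blockedActivity_radius hC (by norm_num) le_rfl⟩

end Shell

/-! ## §4 The registered stub's statement from the construction statement -/

/-- `shellCount 1 = 1776`. -/
theorem shellCount_one : shellCount 1 = 1776 := by
  unfold Summit.QuantumFields.YangMills.Cruxes.IR.OnsetFormats.shellCount
  norm_num

/-- **Lane B closes the reshaped stub BY NAME from its construction statement:**
`BlockedActivityOnsetSC → OnsetFormatsUc.OnsetMixingTypicalUKPcSC` (= `stub_onsetUcSC`'s statement), through the lead's
`SupplierSC.onsetMixingTypicalUKPcSC_of_univOnsetSC` (p524177: Dobrushin–Shlosman bootstrap, class `Typ ≡ univ`) at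
`(n, ε) = (1, 1/3552)`.  CONDITIONAL: `BlockedActivityOnsetSC` is open research content, not claimed. -/
theorem onsetMixingTypicalUKPcSC_of_blockedActivityOnsetSC (h : BlockedActivityOnsetSC) : OnsetMixingTypicalUKPcSC := by
  refine AfPincerUc.SupplierSC.onsetMixingTypicalUKPcSC_of_univOnsetSC fun G _ _ _ _ hG hsc => ?_
  letI : MeasurableSpace G := borel G
  haveI : BorelSpace G := ⟨rfl⟩
  intro r
  refine ⟨1, 1 / 3552, le_rfl, by norm_num, by rw [shellCount_one]; norm_num, ?_⟩
  exact univOnsetAt_of_blockedActivityOnsetAt (h G hG hsc r)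

end Summit.QuantumFields.YangMills.Cruxes.IR.BlockedActivity

end
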